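import Summits.BirchSwinnertonDyer.BirchSwinnertonDyer.Theorems.QuadraticBranchSignedControlPlusEtaNonsurjConjADoorBSDRankOne
import Summits.BirchSwinnertonDyer.BirchSwinnertonDyer.Theorems.QuadraticBranchSignedControlPlusEtaNonsurjConjADoorRecordsPrimeLA
import Summits.BirchSwinnertonDyer.Rank1Residual.X11b.ChaPairsMinimality
import Summits.BirchSwinnertonDyer.Rank1Residual.X11b.KrausMinimalityGeneralTwo
import HarnessLib

/-!
# Route `QuadraticBranchSignedControl` (rung K8, cell `bsd-potss`), residual crux `PlusEtaMainConjectureNonsurj`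
# (stmt-BirchSwinnertonDyer-19606): CONGRUENT-FAMILY `BSD_5` RECORDS R(c) — `MissingPPartAt W 5` on the `λ⁻ ≥ 3` prime-`L` rank-one rows of the congruent
# twist families (doors L6 / L2), modulo named published facts AND the route's declared residual C-cc-1 AT THE ROW, with its sharp numerical prediction
# displayed (seat `bsd-potss-k8eta-c2` g22)

WHAT. Family members with `ε = −1`, plus-`η` `(λ, μ) = (1, 0)`, `r_an = 1`, a door PASS, and minus-`η` `λ⁻ ≥ 3` (g19 etanc/etacomp): here the `δ = 0`
law is NOT numerically trivial — every such row has `5 ∣ Tam` (`c_ℓ = 5` at a split multiplicative prime) — so the record keeps the displayed instance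
`QuadraticBranchMinusLeadingValuationAt W 5 0` and the docstring records the prediction `v₅(coeff₁ L₅⁻(V,η,X)) = 2ν + v₅(#Ш_an·Tam/#tors²)` for a
successor's `L`-series engine. Rows of this part: c5e:17 (`N_W = 70487100`, door L6; λ⁻ = 3, ν = 0, v₅(#Ш_an) = 0, v₅(Tam/#tors²) = 1 ⇒ C-cc-1 predicts v₅(coeff₁ L₅⁻) = 1), c5f:8 (`N_W = 21873600`, door L2; λ⁻ = 5, ν = 0, v₅(#Ш_an) = 0, v₅(Tam/#tors²) = 1 ⇒ C-cc-1 predicts v₅(coeff₁ L₅⁻) = 1), c5d:-8 (`N_W = 10411200`, door L6; λ⁻ = 3, ν = 0, v₅(#Ш_an) = 0, v₅(Tam/#tors²) = 1 ⇒ C-cc-1 predicts v₅(coeff₁ L₅⁻) = 1).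

HONEST FRAMING (cell `bsd-potss`; FULL-BSD rank ≤ 1 programme, HUMAN RULING D-0036/D-0074): per-row RECORDS, CONDITIONAL on the displayed named facts and
per-row data (GRH class numbers, PARI `λ^±, μ^±`, `ellanalyticrank` [, `ellrank` generator + `5`-divisibility, `#Ш_an`, `Tam`, `#tors`], the twin `V` with
its tower clause); numerics are evidence, not kernel facts; `BSD(W,5)` ASSERTED for no pair; C-cc-1 NOT proved; no stub of 19606 proved; crux and route OPEN;
nothing booked. `--supports stmt-BirchSwinnertonDyer-19606`.

References: [Kobayashi2003] Thm. 1.2, 2.2, §4, Thm. 4.1, 6.2–7.4, 9.3; [Kobayashi2013]; [KitajimaOtsuki2018] Main Thm. 1.3; [GrossZagier1986] I (7.3);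
[Mazur1978] Cor. 4.1; [Miller2011LMS] Def. 1.1; [CoatesSujatha2005] §3 (A), Thm. 3.4; [NeukirchANT1999] I §9 (Kraus), III §1; [SilvermanAEC2009] VII.1 Rem. 1.1.
-/

set_option autoImplicit false
set_option linter.dupNamespace false
noncomputable section

open scoped Classical nonZeroDivisors

open CongruenceSubgroup NumberField Field WeierstrassCurve
open Literature.NumberTheory.EllipticCurves Literature.NumberTheory.EllipticCurves.ModularForms
  Literature.NumberTheory.EllipticCurves.Rank1Residual Literature.NumberTheory.EllipticCurves.Rank1Residual.Typed
  Literature.NumberTheory.GaloisRepresentations Literature.NumberTheory.GaloisCohomology Literature.NumberTheory.NumberFields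
  Literature.NumberTheory.EllipticCurves.GreenbergVatsal2000 ZpExtension
open Summit.BirchSwinnertonDyer.Rank1Residual Summit.BirchSwinnertonDyer.Rank1Residual.Additive
open Summit.BirchSwinnertonDyer.Rank1Residual.X11b (isElliptic_of_discOf_ne_zero)
open Summit.BirchSwinnertonDyer.BirchSwinnertonDyer.Theorems
open Summit.BirchSwinnertonDyer.Rank1Residual.X11b (isElliptic_of_discOf_ne_zero isGloballyMinimal_of_krausCriterion_support)

namespace Summit.BirchSwinnertonDyer.BirchSwinnertonDyer.Theorems.EtaConjADoorFamilyBSDRecords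

/-- The `5`-partner of c5e:17, `W = [0, 0, 0, -753423000, -7385081579500]` (non-CM, `N_W = 70487100`; `j(W) = j(A)` for the quadratic twist
`A^{(17)}` of `A = [0,0,0,−104280,−12025372]` (non-CM in-table row curve of partner conductor `243900`, `5`-CONGRUENT to a CM row — k8eta-c2 g8;
CL25-transfer class, here settled binder-free)): `Δ ≠ 0` (kernel). [cite: Zywina2015, Thm. 1.4] -/
theorem isElliptic_c5e_17 : (⟨0, 0, 0, (-753423000), (-7385081579500)⟩ : WeierstrassCurve ℚ).IsElliptic :=
  isElliptic_of_discOf_ne_zero 0 0 0 (-753423000) (-7385081579500) (by decide +kernel)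

set_option maxRecDepth 100000 in
/-- `W = [0, 0, 0, -753423000, -7385081579500]` is a global minimal equation (Silverman VII.1 Rem. 1.1 on the support `|Δ| = 2^8 · 3^3 · 5^6 · 17^6
· 271^5` — at every prime `q` of the support `q¹² ∤ Δ` or `q⁴ ∤ c₄`, or Kraus's test at `2`; tree `isGloballyMinimal_of_krausCriterion_support`,
kernel `decide`). [cite: SilvermanAEC2009, VII.1 Remark 1.1] [cite: Kraus1989, Prop. 1 and Prop. 2] -/
theorem isGloballyMinimal_c5e_17 : (⟨0, 0, 0, (-753423000), (-7385081579500)⟩ : WeierstrassCurve ℚ).IsGloballyMinimal :=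
  isGloballyMinimal_of_krausCriterion_support 0 0 0 (-753423000) (-7385081579500) [(2, 0, 8), (3, 0, 3), (5, 0, 6), (17, 0, 6), (271, 0, 5)]
    (by
      intro t ht
      simp only [List.mem_cons, List.not_mem_nil, or_false] at ht
      rcases ht with rfl | rfl | rfl | rfl | rfl <;> norm_num)
    (by decide +kernel) (by decide +kernel)

/-- **`MissingPPartAt W 5` — `ord_5 #Ш(W) = ord_5 #Ш_an(W)` (from Miller's `BSDp W 5`) — for the CONGRUENT-class (non-CM, `5`-congruent to a CM row;
k8eta-c2 g8/g19) prime-`L` rank-one partner c5e:17, granted ONE good `a_5 = 0` globally minimal model `V` of `W^{(5)}` with non-onto `5`-adic tower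
AND the route's residual crux C-cc-1 AT THIS ROW** (`W = [0, 0, 0, -753423000, -7385081579500]`, non-CM (congruent class c5e), `N_W = 70487100`; kit
j326603 (k8eta-c2 g21, engine e5.gp) + g19 etanc j317325 (77 s, GRH): `ε(W) = −1`, PARI plus-`η` `(λ, μ) = (1, 0)`, `r_an(W) = 1` (`g19`); `h(ℚ(P))
= 4` (`[2, 2]`), `h(ℚ(x(P))) = 1`; eigen dimensions `(d₁,d₂,d₃,d₄) = (0,0,0,0)` — door L6 (`5 ∤ h(ℚ(P))`) passes) from the ROW ALONE — named facts
`hGZK hmod hnf hM h12 hKO hGZ h74 h22 h41 h6273` (GZK, modularity, newforms, Mazur `p ∤ c₀`, Kobayashi Thm. 1.2 / 2.2 / 4.1 / 6.2–7.4,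
Kitajima–Otsuki Thm. 1.3, Gross–Zagier I (7.3); Poitou–Tate and the layer comparison are tree theorems); displayed: `r_an(W) = 1`, the twin `V` with
the tower clause, `(L_5⁺(V,η,X)) = (X)`, and the route's DECLARED RESIDUAL crux C-cc-1 AT THIS ROW (`QuadraticBranchMinusLeadingValuationAt W 5 0`,
the regulator-free `δ = 0` valuation law — OPEN, not certified here; numerically (g19 etacomp): λ⁻ = 3, ν = 0, v₅(#Ш_an) = 0, v₅(Tam/#tors²) = 1 ⇒
C-cc-1 predicts v₅(coeff₁ L₅⁻) = 1), the class-group datum. Instance of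
`EtaConjADoorBSDRankOne.bsdp_of_plusEtaMainConjectureAt_of_analyticRank_eq_one` ∘ g20's `EtaConjADoorRecords.etaMC_r1_of_classNumber` (k8eta-c2
g22). CONDITIONAL; nothing booked. [cite: Kobayashi2003, §4 (p. 8), Thm. 2.2 (p. 5)] [cite: CoatesSujatha2005, §3 (A) and Thm. 3.4] [cite:
Zywina2015, Thm. 1.4] -/
theorem missingPPartAt_r1_c5e_17_5_of_classNumber
    (hGZK : rank_eq_analyticRank_of_analyticRank_le_one) (hmod : hasEntireLFunction_rat)
    (hnf : exists_isNewformOf) (hM : mazur_not_dvd_maninConstant_of_odd)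
    (h12 : Kobayashi2003.thm12_signedSelmerDual_finite_torsion)
    (hKO : KitajimaOtsuki2018.mainThm13_etaSignedSelmerDual_noFiniteSubmodule)
    (hGZ : GrossZagier1986_thm_I_7_3) (h74 : Kobayashi2003.thm74_etaEvenMC_iff_etaOddMC)
    (h22 : Kobayashi2003.thm22_etaSignedSelmerDual_finite_torsion)
    (h41 : Kobayashi2003.thm41_plusEtaCharIdeal_dvd)
    (h6273 : Kobayashi2003.thm62_63_73_etaColemanPoitouTate) [Fact (5 : ℕ).Prime]
    (W : WeierstrassCurve ℚ) (hW : W = (⟨0, 0, 0, (-753423000), (-7385081579500)⟩ : WeierstrassCurve ℚ)) (hr : W.analyticRank = 1)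
    (V : WeierstrassCurve ℚ) [V.IsElliptic] [V.IsGloballyMinimal] (C : VariableChange ℚ)
    (hC : C • W.quadraticTwist 5 = V)
    (hgood : V.HasGoodReductionAtPrime 5) (hap : V.frobeniusTrace 5 = 0)
    (hns : ¬ ∀ m : ℕ, V.HasSurjectiveModNGaloisRep (5 ^ m : ℕ))
    (hX : ∀ {N : ℕ} [NeZero N] {f : CuspForm (Gamma0 N) 2}, IsNewformOf V f →
      ∀ (ϖ : ℚ), (if Even (5 / 2) then (ϖ : ℝ) * V.realPeriodRat = plusPeriod f
          else (ϖ : ℝ) * V.imaginaryPeriodRat = minusPeriod f) →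
      ∀ (Lη : IwasawaAlgebra 5), IsQuadraticBranchPlusLFunction f 5 ϖ Lη →
        Ideal.span {Lη} = Ideal.span {(PowerSeries.X : IwasawaAlgebra 5)})
    (hP : haveI : W.IsElliptic := hW ▸ isElliptic_c5e_17
      haveI : NeZero (5 : ℕ) := ⟨by norm_num⟩
      haveI : NumberField (W.divisionField 5) := NumberField.mk
      ∃ P : geomTorsion W ((5 : ℕ) : ℤ), P ≠ 0 ∧
        ¬ 5 ∣ NumberField.classNumber (IntermediateField.fixedField
          ((MulAction.stabilizer (absoluteGaloisGroup ℚ) P).map (absRestrictNormalHom (W.divisionField 5)))))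
    (hcc1 : haveI : W.IsElliptic := hW ▸ isElliptic_c5e_17
      haveI : W.IsGloballyMinimal := hW ▸ isGloballyMinimal_c5e_17
      QuadraticBranchMinusLeadingValuationAt W 5 0) :
    MissingPPartAt W 5 := by
  subst hW
  haveI : (⟨0, 0, 0, (-753423000), (-7385081579500)⟩ : WeierstrassCurve ℚ).IsElliptic := isElliptic_c5e_17
  haveI : (⟨0, 0, 0, (-753423000), (-7385081579500)⟩ : WeierstrassCurve ℚ).IsGloballyMinimal := isGloballyMinimal_c5e_17
  haveI : NeZero (5 : ℕ) := ⟨by norm_num⟩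
  haveI : Finite (⟨0, 0, 0, (-753423000), (-7385081579500)⟩ : WeierstrassCurve ℚ).sha := (hGZK _ (by omega)).2
  exact missingPPartAt_of_bsdp _ 5 (EtaConjADoorBSDRankOne.bsdp_of_plusEtaMainConjectureAt_of_analyticRank_eq_one _ 5 hGZK hmod hnf hM h12 hKO hGZ h74 (le_refl 5) V C
      (by rw [show ((-1 : ℚ) ^ ((5 : ℕ) / 2) * ((5 : ℕ) : ℚ)) = 5 by norm_num]; exact hC) hgood hap
      (EtaConjADoorRecords.etaMC_r1_of_classNumber h22 h41 h6273 hGZK 5 (le_refl 5) _ hr V C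
        (by rw [show ((-1 : ℚ) ^ ((5 : ℕ) / 2) * ((5 : ℕ) : ℚ)) = 5 by norm_num]; exact hC) hgood hap hns hX hP) hr hcc1)

/-- The `5`-partner of c5f:8, `W = [0, 0, 0, -84000, 362250]` (non-CM, `N_W = 21873600`; `j(W) = j(A)` for the quadratic twist `A^{(8)}` of `A =
[0,0,1,−840,362]` (non-CM in-table row curve of partner conductor `341775`, `5`-CONGRUENT to a CM row — k8eta-c2 g8; CL25-transfer class, here
settled binder-free)): `Δ ≠ 0` (kernel). [cite: Zywina2015, Thm. 1.4] -/
theorem isElliptic_c5f_8 : (⟨0, 0, 0, (-84000), 362250⟩ : WeierstrassCurve ℚ).IsElliptic :=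
  isElliptic_of_discOf_ne_zero 0 0 0 (-84000) 362250 (by decide +kernel)

set_option maxRecDepth 100000 in
/-- `W = [0, 0, 0, -84000, 362250]` is a global minimal equation (Silverman VII.1 Rem. 1.1 on the support `|Δ| = 2^6 · 3^3 · 5^6 · 7^2 · 31^5` — at
every prime `q` of the support `q¹² ∤ Δ` or `q⁴ ∤ c₄`, or Kraus's test at `2`; tree `isGloballyMinimal_of_krausCriterion_support`, kernel `decide`).
[cite: SilvermanAEC2009, VII.1 Remark 1.1] [cite: Kraus1989, Prop. 1 and Prop. 2] -/
theorem isGloballyMinimal_c5f_8 : (⟨0, 0, 0, (-84000), 362250⟩ : WeierstrassCurve ℚ).IsGloballyMinimal :=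
  isGloballyMinimal_of_krausCriterion_support 0 0 0 (-84000) 362250 [(2, 0, 6), (3, 0, 3), (5, 0, 6), (7, 0, 2), (31, 0, 5)]
    (by
      intro t ht
      simp only [List.mem_cons, List.not_mem_nil, or_false] at ht
      rcases ht with rfl | rfl | rfl | rfl | rfl <;> norm_num)
    (by decide +kernel) (by decide +kernel)

/-- **`MissingPPartAt W 5` — `ord_5 #Ш(W) = ord_5 #Ш_an(W)` (from Miller's `BSDp W 5`) — for the CONGRUENT-class (non-CM, `5`-congruent to a CM row;
k8eta-c2 g8/g19) prime-`L` rank-one partner c5f:8, granted ONE good `a_5 = 0` globally minimal model `V` of `W^{(5)}` with non-onto `5`-adic tower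
AND the route's residual crux C-cc-1 AT THIS ROW** (`W = [0, 0, 0, -84000, 362250]`, non-CM (congruent class c5f), `N_W = 21873600`; kit j326603
(k8eta-c2 g21, engine e5.gp) + g19 etanc j317325 (119 s, GRH): `ε(W) = −1`, PARI plus-`η` `(λ, μ) = (1, 0)`, `r_an(W) = 1` (`g19`); `h(ℚ(P)) = 120`
(`[30, 2, 2]`), `h(ℚ(x(P))) = 3`; eigen dimensions `(d₁,d₂,d₃,d₄) = (0,0,1,0)` — door L2 (`2` is not an eigenvalue of `σ₂`) passes) from the ROW
ALONE — named facts `hGZK hmod hnf hM h12 hKO hGZ h74 h22 h41 h6273` (GZK, modularity, newforms, Mazur `p ∤ c₀`, Kobayashi Thm. 1.2 / 2.2 / 4.1 /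
6.2–7.4, Kitajima–Otsuki Thm. 1.3, Gross–Zagier I (7.3); Poitou–Tate and the layer comparison are tree theorems); displayed: `r_an(W) = 1`, the twin
`V` with the tower clause, `(L_5⁺(V,η,X)) = (X)`, and the route's DECLARED RESIDUAL crux C-cc-1 AT THIS ROW (`QuadraticBranchMinusLeadingValuationAt
W 5 0`, the regulator-free `δ = 0` valuation law — OPEN, not certified here; numerically (g19 etacomp): λ⁻ = 5, ν = 0, v₅(#Ш_an) = 0, v₅(Tam/#tors²)
= 1 ⇒ C-cc-1 predicts v₅(coeff₁ L₅⁻) = 1), the class-group datum. Instance of `EtaConjADoorBSDRankOne.bsdp_r1_of_eigenHom` (k8eta-c2 g22).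
CONDITIONAL; nothing booked. [cite: Kobayashi2003, §4 (p. 8), Thm. 2.2 (p. 5)] [cite: CoatesSujatha2005, §3 (A) and Thm. 3.4] [cite: Zywina2015,
Thm. 1.4] -/
theorem missingPPartAt_r1_c5f_8_5_of_eigenHom
    (hGZK : rank_eq_analyticRank_of_analyticRank_le_one) (hmod : hasEntireLFunction_rat)
    (hnf : exists_isNewformOf) (hM : mazur_not_dvd_maninConstant_of_odd)
    (h12 : Kobayashi2003.thm12_signedSelmerDual_finite_torsion)
    (hKO : KitajimaOtsuki2018.mainThm13_etaSignedSelmerDual_noFiniteSubmodule)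
    (hGZ : GrossZagier1986_thm_I_7_3) (h74 : Kobayashi2003.thm74_etaEvenMC_iff_etaOddMC)
    (h22 : Kobayashi2003.thm22_etaSignedSelmerDual_finite_torsion)
    (h41 : Kobayashi2003.thm41_plusEtaCharIdeal_dvd)
    (h6273 : Kobayashi2003.thm62_63_73_etaColemanPoitouTate) [Fact (5 : ℕ).Prime]
    (W : WeierstrassCurve ℚ) (hW : W = (⟨0, 0, 0, (-84000), 362250⟩ : WeierstrassCurve ℚ)) (hr : W.analyticRank = 1)
    (V : WeierstrassCurve ℚ) [V.IsElliptic] [V.IsGloballyMinimal] (C : VariableChange ℚ)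
    (hC : C • W.quadraticTwist 5 = V)
    (hgood : V.HasGoodReductionAtPrime 5) (hap : V.frobeniusTrace 5 = 0)
    (hns : ¬ ∀ m : ℕ, V.HasSurjectiveModNGaloisRep (5 ^ m : ℕ))
    (hX : ∀ {N : ℕ} [NeZero N] {f : CuspForm (Gamma0 N) 2}, IsNewformOf V f →
      ∀ (ϖ : ℚ), (if Even (5 / 2) then (ϖ : ℝ) * V.realPeriodRat = plusPeriod f
          else (ϖ : ℝ) * V.imaginaryPeriodRat = minusPeriod f) →
      ∀ (Lη : IwasawaAlgebra 5), IsQuadraticBranchPlusLFunction f 5 ϖ Lη →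
        Ideal.span {Lη} = Ideal.span {(PowerSeries.X : IwasawaAlgebra 5)})
    (hP : haveI : W.IsElliptic := hW ▸ isElliptic_c5f_8
      haveI : NeZero (5 : ℕ) := ⟨by norm_num⟩
      haveI : NumberField (W.divisionField 5) := NumberField.mk
      ∃ P : geomTorsion W ((5 : ℕ) : ℤ), P ≠ 0 ∧
        ∀ K : IntermediateField ℚ (W.divisionField 5),
          K = IntermediateField.fixedField
            ((MulAction.stabilizer (absoluteGaloisGroup ℚ) P).map (absRestrictNormalHom (W.divisionField 5))) →
        ∀ μ : Additive (ClassGroup (𝓞 K)) →+ ZMod 5,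
          (∀ (τ : absoluteGaloisGroup ℚ) (σ : K ≃ₐ[ℚ] K) (a : ℕ),
              (∀ x : K, absRestrictNormalHom (W.divisionField 5) τ (x : W.divisionField 5) =
                ((σ x : K) : W.divisionField 5)) → τ • P = a • P →
              ∀ (I J : (Ideal (𝓞 K))⁰),
                (J : Ideal (𝓞 K)) = (I : Ideal (𝓞 K)).map (AmbiguousClass.intAut σ : 𝓞 K →+* 𝓞 K) →
                μ (Additive.ofMul (ClassGroup.mk0 J)) = a • μ (Additive.ofMul (ClassGroup.mk0 I))) →
          μ = 0)
    (hcc1 : haveI : W.IsElliptic := hW ▸ isElliptic_c5f_8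
      haveI : W.IsGloballyMinimal := hW ▸ isGloballyMinimal_c5f_8
      QuadraticBranchMinusLeadingValuationAt W 5 0) :
    MissingPPartAt W 5 := by
  subst hW
  haveI : (⟨0, 0, 0, (-84000), 362250⟩ : WeierstrassCurve ℚ).IsElliptic := isElliptic_c5f_8
  haveI : (⟨0, 0, 0, (-84000), 362250⟩ : WeierstrassCurve ℚ).IsGloballyMinimal := isGloballyMinimal_c5f_8
  haveI : NeZero (5 : ℕ) := ⟨by norm_num⟩
  haveI : Finite (⟨0, 0, 0, (-84000), 362250⟩ : WeierstrassCurve ℚ).sha := (hGZK _ (by omega)).2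
  exact missingPPartAt_of_bsdp _ 5 (EtaConjADoorBSDRankOne.bsdp_r1_of_eigenHom _ 5 hGZK hmod hnf hM h12 hKO hGZ h74 h22 h41 h6273 (le_refl 5) hr V C
    (by rw [show ((-1 : ℚ) ^ ((5 : ℕ) / 2) * ((5 : ℕ) : ℚ)) = 5 by norm_num]; exact hC) hgood hap hns hX hP hcc1)

/-- The `5`-partner of c5d:-8, `W = [0, 0, 0, -4611000, -3870549250]` (non-CM, `N_W = 10411200`; `j(W) = j(A)` for the quadratic twist `A^{(-8)}` of
`A = [0,0,1,−46110,3870549]` (non-CM row curve of partner conductor `162675`, `5`-CONGRUENT to a CM row — k8eta-c2 g8; CL25-transfer class, here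
settled binder-free)): `Δ ≠ 0` (kernel). [cite: Zywina2015, Thm. 1.4] -/
theorem isElliptic_c5d_m8 : (⟨0, 0, 0, (-4611000), (-3870549250)⟩ : WeierstrassCurve ℚ).IsElliptic :=
  isElliptic_of_discOf_ne_zero 0 0 0 (-4611000) (-3870549250) (by decide +kernel)

set_option maxRecDepth 100000 in
/-- `W = [0, 0, 0, -4611000, -3870549250]` is a global minimal equation (Silverman VII.1 Rem. 1.1 on the support `|Δ| = 2^6 · 3^5 · 5^6 · 241^5` —
at every prime `q` of the support `q¹² ∤ Δ` or `q⁴ ∤ c₄`, or Kraus's test at `2`; tree `isGloballyMinimal_of_krausCriterion_support`, kernel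
`decide`). [cite: SilvermanAEC2009, VII.1 Remark 1.1] [cite: Kraus1989, Prop. 1 and Prop. 2] -/
theorem isGloballyMinimal_c5d_m8 : (⟨0, 0, 0, (-4611000), (-3870549250)⟩ : WeierstrassCurve ℚ).IsGloballyMinimal :=
  isGloballyMinimal_of_krausCriterion_support 0 0 0 (-4611000) (-3870549250) [(2, 0, 6), (3, 0, 5), (5, 0, 6), (241, 0, 5)]
    (by
      intro t ht
      simp only [List.mem_cons, List.not_mem_nil, or_false] at ht
      rcases ht with rfl | rfl | rfl | rfl <;> norm_num)
    (by decide +kernel) (by decide +kernel)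

/-- **`MissingPPartAt W 5` — `ord_5 #Ш(W) = ord_5 #Ш_an(W)` (from Miller's `BSDp W 5`) — for the CONGRUENT-class (non-CM, `5`-congruent to a CM row;
k8eta-c2 g8/g19) prime-`L` rank-one partner c5d:-8, granted ONE good `a_5 = 0` globally minimal model `V` of `W^{(5)}` with non-onto `5`-adic tower
AND the route's residual crux C-cc-1 AT THIS ROW** (`W = [0, 0, 0, -4611000, -3870549250]`, non-CM (congruent class c5d), `N_W = 10411200`; kit
j326603 (k8eta-c2 g21, engine e5.gp) + g19 etanc j317325 (17 s, GRH): `ε(W) = −1`, PARI plus-`η` `(λ, μ) = (1, 0)`, `r_an(W) = 1` (`g19`); `h(ℚ(P))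
= 2` (`[2]`), `h(ℚ(x(P))) = 1`; eigen dimensions `(d₁,d₂,d₃,d₄) = (0,0,0,0)` — door L6 (`5 ∤ h(ℚ(P))`) passes) from the ROW ALONE — named facts
`hGZK hmod hnf hM h12 hKO hGZ h74 h22 h41 h6273` (GZK, modularity, newforms, Mazur `p ∤ c₀`, Kobayashi Thm. 1.2 / 2.2 / 4.1 / 6.2–7.4,
Kitajima–Otsuki Thm. 1.3, Gross–Zagier I (7.3); Poitou–Tate and the layer comparison are tree theorems); displayed: `r_an(W) = 1`, the twin `V` with
the tower clause, `(L_5⁺(V,η,X)) = (X)`, and the route's DECLARED RESIDUAL crux C-cc-1 AT THIS ROW (`QuadraticBranchMinusLeadingValuationAt W 5 0`,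
the regulator-free `δ = 0` valuation law — OPEN, not certified here; numerically (g19 etacomp): λ⁻ = 3, ν = 0, v₅(#Ш_an) = 0, v₅(Tam/#tors²) = 1 ⇒
C-cc-1 predicts v₅(coeff₁ L₅⁻) = 1), the class-group datum. Instance of
`EtaConjADoorBSDRankOne.bsdp_of_plusEtaMainConjectureAt_of_analyticRank_eq_one` ∘ g20's `EtaConjADoorRecords.etaMC_r1_of_classNumber` (k8eta-c2
g22). CONDITIONAL; nothing booked. [cite: Kobayashi2003, §4 (p. 8), Thm. 2.2 (p. 5)] [cite: CoatesSujatha2005, §3 (A) and Thm. 3.4] [cite: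
Zywina2015, Thm. 1.4] -/
theorem missingPPartAt_r1_c5d_m8_5_of_classNumber
    (hGZK : rank_eq_analyticRank_of_analyticRank_le_one) (hmod : hasEntireLFunction_rat)
    (hnf : exists_isNewformOf) (hM : mazur_not_dvd_maninConstant_of_odd)
    (h12 : Kobayashi2003.thm12_signedSelmerDual_finite_torsion)
    (hKO : KitajimaOtsuki2018.mainThm13_etaSignedSelmerDual_noFiniteSubmodule)
    (hGZ : GrossZagier1986_thm_I_7_3) (h74 : Kobayashi2003.thm74_etaEvenMC_iff_etaOddMC)
    (h22 : Kobayashi2003.thm22_etaSignedSelmerDual_finite_torsion)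
    (h41 : Kobayashi2003.thm41_plusEtaCharIdeal_dvd)
    (h6273 : Kobayashi2003.thm62_63_73_etaColemanPoitouTate) [Fact (5 : ℕ).Prime]
    (W : WeierstrassCurve ℚ) (hW : W = (⟨0, 0, 0, (-4611000), (-3870549250)⟩ : WeierstrassCurve ℚ)) (hr : W.analyticRank = 1)
    (V : WeierstrassCurve ℚ) [V.IsElliptic] [V.IsGloballyMinimal] (C : VariableChange ℚ)
    (hC : C • W.quadraticTwist 5 = V)
    (hgood : V.HasGoodReductionAtPrime 5) (hap : V.frobeniusTrace 5 = 0)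
    (hns : ¬ ∀ m : ℕ, V.HasSurjectiveModNGaloisRep (5 ^ m : ℕ))
    (hX : ∀ {N : ℕ} [NeZero N] {f : CuspForm (Gamma0 N) 2}, IsNewformOf V f →
      ∀ (ϖ : ℚ), (if Even (5 / 2) then (ϖ : ℝ) * V.realPeriodRat = plusPeriod f
          else (ϖ : ℝ) * V.imaginaryPeriodRat = minusPeriod f) →
      ∀ (Lη : IwasawaAlgebra 5), IsQuadraticBranchPlusLFunction f 5 ϖ Lη →
        Ideal.span {Lη} = Ideal.span {(PowerSeries.X : IwasawaAlgebra 5)})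
    (hP : haveI : W.IsElliptic := hW ▸ isElliptic_c5d_m8
      haveI : NeZero (5 : ℕ) := ⟨by norm_num⟩
      haveI : NumberField (W.divisionField 5) := NumberField.mk
      ∃ P : geomTorsion W ((5 : ℕ) : ℤ), P ≠ 0 ∧
        ¬ 5 ∣ NumberField.classNumber (IntermediateField.fixedField
          ((MulAction.stabilizer (absoluteGaloisGroup ℚ) P).map (absRestrictNormalHom (W.divisionField 5)))))
    (hcc1 : haveI : W.IsElliptic := hW ▸ isElliptic_c5d_m8
      haveI : W.IsGloballyMinimal := hW ▸ isGloballyMinimal_c5d_m8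
      QuadraticBranchMinusLeadingValuationAt W 5 0) :
    MissingPPartAt W 5 := by
  subst hW
  haveI : (⟨0, 0, 0, (-4611000), (-3870549250)⟩ : WeierstrassCurve ℚ).IsElliptic := isElliptic_c5d_m8
  haveI : (⟨0, 0, 0, (-4611000), (-3870549250)⟩ : WeierstrassCurve ℚ).IsGloballyMinimal := isGloballyMinimal_c5d_m8
  haveI : NeZero (5 : ℕ) := ⟨by norm_num⟩
  haveI : Finite (⟨0, 0, 0, (-4611000), (-3870549250)⟩ : WeierstrassCurve ℚ).sha := (hGZK _ (by omega)).2
  exact missingPPartAt_of_bsdp _ 5 (EtaConjADoorBSDRankOne.bsdp_of_plusEtaMainConjectureAt_of_analyticRank_eq_one _ 5 hGZK hmod hnf hM h12 hKO hGZ h74 (le_refl 5) V C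
      (by rw [show ((-1 : ℚ) ^ ((5 : ℕ) / 2) * ((5 : ℕ) : ℚ)) = 5 by norm_num]; exact hC) hgood hap
      (EtaConjADoorRecords.etaMC_r1_of_classNumber h22 h41 h6273 hGZK 5 (le_refl 5) _ hr V C
        (by rw [show ((-1 : ℚ) ^ ((5 : ℕ) / 2) * ((5 : ℕ) : ℚ)) = 5 by norm_num]; exact hC) hgood hap hns hX hP) hr hcc1)

end Summit.BirchSwinnertonDyer.BirchSwinnertonDyer.Theorems.EtaConjADoorFamilyBSDRecords

end
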